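import Mathlib
import HarnessLib
import Literature.MathematicalPhysics.QuantumFieldTheory.AndersonKruczenski2017.LargeNPlaquetteBounds

/-!
# Anderson–Kruczenski, *Loop equations and bootstrap methods in the lattice* (Nucl. Phys. B 921 (2017) 702–726,
# arXiv:1612.08140), §3 "Two dimensional lattice", continued: the recursion (a49) determines every loop from the
# plaquette, the Gross–Witten action is minimised by the strong-coupling sequence, the Toeplitz positivity constraint
# implies the printed action-independent bounds, and the strong-coupling sequence passes positivity iff `λ ≥ 1` —
# every statement PROVED

**Source.** P. D. Anderson, M. Kruczenski, *Loop equations and bootstrap methods in the lattice*, Nucl. Phys. B **921**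
(2017) 702–726, doi:10.1016/j.nuclphysb.2017.06.009, arXiv:1612.08140 [AndersonKruczenski2017], §3 (held corpus text
`paper:arxiv-1612.08140`, chunks p0007–p0009).  Equation labels `(aNN)` are the `\label`s of the arXiv TeX source, the
convention of the sibling module `…AndersonKruczenski2017.LargeNPlaquetteBounds` (R141 (D) item (11), seat ym-lit-type-8;
its §5 (v1.1) folds the §3 vocabulary `LoopEq2D`, `gwStrong`, `exactPlaquette2D`, `toeplitz`, `rhoMatrix` from this seat's
earlier draft).  This file is a SIBLING in the same namespace and REUSES that vocabulary and the `ρ`-matrix lemmas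
`gram2`, `gram3`, `abs_le_one_of_gram2`, `sq_sub_le_of_gram3`, `sq_sub_le_four_mul` by name — nothing is restated.

**What the paper prints (verbatim, TeX extraction; corpus p0007–p0009).**  §3.1, after *"`ρ^{(L)} = (1/L)𝕋[𝒲₀,…,𝒲_L]
⪰ 0`"* (a31)–(a34): *"From these constraints one can derive some simple results that are completely independent of the
action that we choose: For example taking the principal minor `[[1, 𝒲_n],[𝒲_n, 1]] ⪰ 0` implies that all loops satisfy
`|𝒲_n| ≤ 1` as we already know.  Taking another principal minor `[[1, 𝒲₁, 𝒲_n],[𝒲₁, 1, 𝒲_{n−1}],[𝒲_n, 𝒲_{n−1}, 1]] ⪰ 0`,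
we obtain `(𝒲_n − 𝒲_{n−1})² ≤ (1−u)(1+u−2𝒲_n𝒲_{n−1})`, and therefore, if `𝒲₁ = u = 1` then all loops are equal
`𝒲_n = 1` independently of the action!  If `u < 1` we have an interesting inequality that bounds the rate of change in the
Wilson loop expectation value `(𝒲_n − 𝒲_{n−1})² ≤ 4(1−u)`"* (a36)–(a39).  §3.2: *"we get, up to an additive constant, a
simple effective action for the Wilson loops `S = −(1/λ)𝒲₁ + Σ_{n=1}^{∞} (1/n)𝒲_n²`.  Minimizing this action with respect
to the `𝒲_n` trivially gives `𝒲₁ = 1/(2λ)`, `𝒲_{n≥2} = 0`, namely the strong coupling solution.  However, for `λ < 1` the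
corresponding matrices `ρ^{L}` are not all positive definite.  Indeed, their eigenvalues are
`μ_j^{(L)} = 1 + (1/λ) cos(πk/(L+1))`, `k = 1…L+1` that are not all positive for `λ < 1`"* (a46)–(a48); §3.1 last bullet:
*"For finite `L`, the strong coupling solutions lies in the interior and the weak coupling ones at the boundary."*  §3.3,
after the loop equation (a49): *"It is clear that, if we give a value to `𝒲₁ = u`, then all the other Wilson loops are
fixed recursively. The equation is very powerful but unfortunately it still leaves an infinite number of solutions, one
for each value of `u`."*  §3.4: *"This polynomial has always a root `u = 1/(2λ)` that corresponds to the strong coupling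
solution."*

**What this file types (and proves).**  Everything is elementary real algebra about a real sequence `W : ℕ → ℝ` standing
for the planar loop values `𝒲_n`; no measure, no large-`N` limit, no gauge theory is constructed or asserted.
* §1 (the recursion (a49)): `LoopEq2D.W_succ_succ` (solved form), `LoopEq2D.W_three`, **`LoopEq2D.ext_of_W_one`** (two
  solutions at the same `λ` with the same plaquette `𝒲₁` coincide — *"fixed recursively"*, PROVED by strong induction),
  **`LoopEq2D.eq_gwStrong`** (a solution with `𝒲₁ = 1/(2λ)` IS the strong-coupling sequence: the printed *"always a root
  `u = 1/(2λ)`"* read as `𝒲_{L+1} = 0` for every `L`), `exactPlaquette2D_le_gwStrong_one` (for `λ > 0` the exact plaquette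
  (a28) never exceeds that root; the weak-coupling gap is `(1−λ)²/(2λ)`).
* §2 (the Gross–Witten action (a47), truncated at `n ≤ L`): `gwAction λ L W`, `gwAction_sub_gwAction_gwStrong` (completing
  the square), **`gwAction_gwStrong_le`** and **`gwAction_eq_gwStrong_iff`** — the strong-coupling sequence is the unique
  minimiser on the coordinates `𝒲₁,…,𝒲_L` (the printed *"trivially gives"*), for every `L ≥ 1` and `λ ≠ 0`.
* §3 (Toeplitz positivity ⇒ the printed action-independent bounds): `toeplitz_isHermitian`; the printed principal minors
  as `Matrix.submatrix` identities `toeplitz_submatrix_pair` (= `gram2 (W n)`), `toeplitz_submatrix_triple`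
  (= `gram3 (W (n+1)) (W n) (W 1)`); **`abs_le_one_of_toeplitz`** (a36), **`sq_sub_le_of_toeplitz`** (a38),
  `sq_sub_le_four_mul_of_toeplitz` (a39), **`all_loops_one_of_toeplitz`** (*"independently of the action!"*) — all from
  the single hypothesis `(toeplitz W L).PosSemidef` (+ `𝒲₀ = 1`), i.e. the constraint (a31) exactly as a bootstrap imposes
  it (the sibling's `all_loops_one` takes the `3 × 3` minors themselves as hypotheses).
* §4 (the strong-coupling sequence against positivity, §3.2 after (a47)): `toeplitz_gwStrong_quadForm`
  (`xᵀ𝕋x = ‖x‖² + (1/λ)Σ_{k<L} x_k x_{k+1}` for `𝕋 = 𝕋[1, 1/(2λ), 0, …, 0]`), **`toeplitz_gwStrong_not_posSemidef`**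
  (`0 < λ`, `λ(L+1) < L` ⇒ not positive semi-definite; witness the alternating vector, value `L + 1 − L/λ`),
  **`exists_toeplitz_gwStrong_not_posSemidef`** (every `0 < λ < 1` is excluded at some finite `L` — the printed *"not all
  positive definite … for `λ < 1`"*), and conversely **`toeplitz_gwStrong_posSemidef`** (`λ ≥ 1` ⇒ positive semi-definite
  for every `L`, since `xᵀ𝕋x ≥ (1 − 1/λ)‖x‖²`).  Together with the sibling's `gwStrong_loopEq2D`: the root `u = 1/(2λ)`
  of the loop equations passes all the positivity constraints (a31) iff `λ ≥ 1` — the Gross–Witten point `λ = 1` as the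
  loop-equation∕positivity bootstrap sees it.  (AK's eigenvalue formula itself is not reproduced; the alternating vector
  certifies the same conclusion, its threshold `λ < L/(L+1)` tending to the printed `λ < 1`.)

**HONEST FRAMING / what is NOT here.**  (i) That the planar (`N = ∞`) loop values of the 2D Wilson theory exist and satisfy
(a49) or (a31) is the paper's starting point (Gross–Witten 1980, Friedan 1981) and is not asserted; every statement is
about all real sequences satisfying the typed hypotheses.  (ii) The generating function (a50), the density condition (a52)
selecting the weak-coupling solution, Marchesini's truncation §3.4 beyond the root `1/(2λ)`, the numerics §§3.5–3.6 and
the entropy remarks are not typed.  (iii) Szegő asymptotics (AK after (a34)) live in `Literature/Analysis/Toeplitz/`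
(complex symbols) and are not used.  (iv) No claim about `N → ∞`, `d = 4`, confinement or a mass gap is made or implied.
Zero `Prop`-valued definitions and zero named facts are introduced; the one new definition, `gwAction`, has a body.

Consumer: the YM instrument cell crew (a) (`run/shared/lean/pub/ym-instrument/`, Q-A1∕Q-A2 — the exactly solvable
calibration case of the loop-equation∕positivity bootstrap: what "loop equation + positivity" does and does not pin down
in closed form); R141 (D) item (11) (seat ym-lit-type-7, gen 2).
-/

noncomputable section

open Matrix Finset

namespace Literature.MathematicalPhysics.QuantumFieldTheory.AndersonKruczenski2017

/-! ## §1. The recursion (a49) determines every loop from the plaquette (AK §3.3–3.4) -/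

namespace LoopEq2D

variable {lam : ℝ} {W W' : ℕ → ℝ}

/-- The side condition `𝒲₀ = 1` of (a49). [cite: AndersonKruczenski2017, §3.3 eq. (a49)] -/
theorem W_zero (h : LoopEq2D lam W) : W 0 = 1 := h.1

/-- (a49) solved for the longest loop: `𝒲_{n+2} = 𝒲_n − 2λ𝒲_{n+1} − 2λΣ_{p=1}^{n}𝒲_p𝒲_{n+1−p}` (the equation of the loop
`𝒲_{n+1}`). [cite: AndersonKruczenski2017, §3.3 eq. (a49)] -/
theorem W_succ_succ (h : LoopEq2D lam W) (n : ℕ) :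
    W (n + 2) = W n - 2 * lam * W (n + 1) - 2 * lam * ∑ p ∈ Finset.Ioo 0 (n + 1), W p * W (n + 1 - p) := by
  have e := h.2 (n + 1) (Nat.succ_pos n)
  simp only [Nat.add_sub_cancel] at e
  have e' : W (n + 2) = W (n + 1 + 1) := rfl
  linarith

/-- The second recursion step: `𝒲₃ = 𝒲₁ − 2λ𝒲₂ − 2λ𝒲₁²`. [cite: AndersonKruczenski2017, §3.3 eq. (a49)] -/
theorem W_three (h : LoopEq2D lam W) : W 3 = W 1 - 2 * lam * W 2 - 2 * lam * W 1 ^ 2 := by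
  have e := h.W_succ_succ 1
  have hI : Finset.Ioo 0 2 = ({1} : Finset ℕ) := by decide
  simp only [Nat.reduceAdd, hI, Finset.sum_singleton, Nat.reduceSub] at e
  linarith

/-- **"If we give a value to `𝒲₁ = u`, then all the other Wilson loops are fixed recursively"**: two solutions of (a49)
at the same coupling with the same plaquette value coincide (*"an infinite number of solutions, one for each value of
`u`"* — and no more).  PROVED (strong induction on the loop index).
[cite: AndersonKruczenski2017, §3.3 (the two sentences after eq. (a49))] -/
theorem ext_of_W_one (h : LoopEq2D lam W) (h' : LoopEq2D lam W') (hu : W 1 = W' 1) : W = W' := by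
  funext n
  induction n using Nat.strong_induction_on with
  | _ n ih =>
    rcases n with _ | n
    · rw [h.1, h'.1]
    rcases n with _ | n
    · exact hu
    have hc : ∑ p ∈ Finset.Ioo 0 (n + 1), W p * W (n + 1 - p) =
        ∑ p ∈ Finset.Ioo 0 (n + 1), W' p * W' (n + 1 - p) := by
      refine Finset.sum_congr rfl fun p hp => ?_
      rw [Finset.mem_Ioo] at hp
      rw [ih p (by omega), ih (n + 1 - p) (by omega)]
    show W (n + 2) = W' (n + 2)
    rw [h.W_succ_succ, h'.W_succ_succ, ih n (by omega), ih (n + 1) (by omega), hc]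

/-- Conversely to `gwStrong_loopEq2D`: a solution of (a49) with plaquette `u = 1/(2λ)` IS the strong-coupling sequence,
so with this `u` the recursion returns `𝒲_n = 0` for all `n ≥ 2` — Marchesini's polynomial `P_L(λ, u) = 𝒲_{L+1}`
*"has always a root `u = 1/(2λ)` that corresponds to the strong coupling solution"*, for every `L`.  PROVED.
[cite: AndersonKruczenski2017, §3.4 (the sentence on the root `u = 1/(2λ)`); §3.3 eq. (a49)] -/
theorem eq_gwStrong (hlam : lam ≠ 0) (h : LoopEq2D lam W) (hu : W 1 = 1 / (2 * lam)) : W = gwStrong lam :=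
  h.ext_of_W_one (gwStrong_loopEq2D hlam) (by rw [hu]; simp [gwStrong])

end LoopEq2D

/-- For every `λ > 0` the exact planar plaquette (a28) is `≤ 1/(2λ)`, the plaquette of the strong-coupling sequence: on the
weak-coupling branch `1/(2λ) − (1 − λ/2) = (1−λ)²/(2λ) ≥ 0` — the loop equations alone admit the root `1/(2λ)` at every
coupling, *"so more constraints are needed at small coupling"* (positivity, §4 below). [cite: AndersonKruczenski2017, §3 eq. (a28); §3.3] -/
theorem exactPlaquette2D_le_gwStrong_one {lam : ℝ} (hlam : 0 < lam) : exactPlaquette2D lam ≤ gwStrong lam 1 := by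
  have h1 : gwStrong lam 1 = 1 / (2 * lam) := by simp [gwStrong]
  rw [h1]
  unfold exactPlaquette2D
  split_ifs with h
  · have key : 1 / (2 * lam) - (1 - lam / 2) = (1 - lam) ^ 2 / (2 * lam) := by
      field_simp
      ring
    have : 0 ≤ (1 - lam) ^ 2 / (2 * lam) := by positivity
    linarith
  · exact le_rfl

/-! ## §2. The Gross–Witten action (a47) is minimised by the strong-coupling sequence (AK §3.2) -/

/-- **The Gross–Witten effective action in loop variables, truncated at `L`**: `S_L(W) = −(1/λ)𝒲₁ + Σ_{n=1}^{L} (1/n)𝒲_n²`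
(the printed (a47) has `L = ∞`; the printed coordinate-wise minimisation only ever sees finitely many `n`, and every
finite truncation is typed). [cite: AndersonKruczenski2017, §3.2 eqs. (a46)–(a47)] -/
def gwAction (lam : ℝ) (L : ℕ) (W : ℕ → ℝ) : ℝ :=
  -(1 / lam) * W 1 + ∑ n ∈ Finset.Icc 1 L, (1 / (n : ℝ)) * W n ^ 2

/-- Completing the square in (a47): `S_L(W) − S_L(strong) = (𝒲₁ − 1/(2λ))² + Σ_{n=2}^{L} (1/n)𝒲_n²` (`L ≥ 1`, `λ ≠ 0`).
[cite: AndersonKruczenski2017, §3.2 (the sentence after eq. (a47))] -/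
theorem gwAction_sub_gwAction_gwStrong {lam : ℝ} (hlam : lam ≠ 0) {L : ℕ} (hL : 1 ≤ L) (W : ℕ → ℝ) :
    gwAction lam L W - gwAction lam L (gwStrong lam) =
      (W 1 - 1 / (2 * lam)) ^ 2 + ∑ n ∈ Finset.Icc 2 L, (1 / (n : ℝ)) * W n ^ 2 := by
  unfold gwAction
  have hsplit : ∀ f : ℕ → ℝ, ∑ n ∈ Finset.Icc 1 L, f n = f 1 + ∑ n ∈ Finset.Icc 2 L, f n := by
    intro f
    have hI : Finset.Icc 1 L = insert 1 (Finset.Icc 2 L) := by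
      ext n
      simp only [Finset.mem_Icc, Finset.mem_insert]
      omega
    rw [hI, Finset.sum_insert (by simp)]
  rw [hsplit, hsplit]
  have hz : ∑ n ∈ Finset.Icc 2 L, (1 / (n : ℝ)) * gwStrong lam n ^ 2 = 0 := by
    refine Finset.sum_eq_zero fun n hn => ?_
    rw [Finset.mem_Icc] at hn
    have h0 : n ≠ 0 := by omega
    have h1 : n ≠ 1 := by omega
    simp [gwStrong, h0, h1]
  have hg1 : gwStrong lam 1 = 1 / (2 * lam) := by simp [gwStrong]
  rw [hz, hg1]
  push_cast
  field_simp
  ring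

/-- **"Minimizing this action with respect to the `𝒲_n` trivially gives `𝒲₁ = 1/(2λ)`, `𝒲_{n≥2} = 0`"**: the
strong-coupling sequence minimises every truncation `S_L`, `L ≥ 1`, over all real sequences.  PROVED.
[cite: AndersonKruczenski2017, §3.2 (the sentence after eq. (a47))] -/
theorem gwAction_gwStrong_le {lam : ℝ} (hlam : lam ≠ 0) {L : ℕ} (hL : 1 ≤ L) (W : ℕ → ℝ) :
    gwAction lam L (gwStrong lam) ≤ gwAction lam L W := by
  have h := gwAction_sub_gwAction_gwStrong hlam hL W
  have hS : 0 ≤ ∑ n ∈ Finset.Icc 2 L, (1 / (n : ℝ)) * W n ^ 2 :=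
    Finset.sum_nonneg fun n _ => by positivity
  nlinarith [sq_nonneg (W 1 - 1 / (2 * lam))]

/-- … and it is the UNIQUE minimiser on the coordinates `𝒲₁,…,𝒲_L` that `S_L` sees.  PROVED.
[cite: AndersonKruczenski2017, §3.2 (the sentence after eq. (a47))] -/
theorem gwAction_eq_gwStrong_iff {lam : ℝ} (hlam : lam ≠ 0) {L : ℕ} (hL : 1 ≤ L) (W : ℕ → ℝ) :
    gwAction lam L W = gwAction lam L (gwStrong lam) ↔ ∀ n ∈ Finset.Icc 1 L, W n = gwStrong lam n := by
  rw [← sub_eq_zero, gwAction_sub_gwAction_gwStrong hlam hL W]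
  have hterm : ∀ n ∈ Finset.Icc 2 L, 0 ≤ (1 / (n : ℝ)) * W n ^ 2 := fun n _ => by positivity
  constructor
  · intro h n hn
    rw [Finset.mem_Icc] at hn
    have hS0 : 0 ≤ ∑ n ∈ Finset.Icc 2 L, (1 / (n : ℝ)) * W n ^ 2 := Finset.sum_nonneg hterm
    have h1 : (W 1 - 1 / (2 * lam)) ^ 2 = 0 := by
      nlinarith [sq_nonneg (W 1 - 1 / (2 * lam))]
    have hS : ∑ n ∈ Finset.Icc 2 L, (1 / (n : ℝ)) * W n ^ 2 = 0 := by linarith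
    rcases Nat.lt_or_ge n 2 with hlt | hge
    · obtain rfl : n = 1 := by omega
      have hg1 : gwStrong lam 1 = 1 / (2 * lam) := by simp [gwStrong]
      rw [hg1]
      exact sub_eq_zero.mp ((pow_eq_zero_iff two_ne_zero).mp h1)
    · have hg : gwStrong lam n = 0 := by
        have h0 : n ≠ 0 := by omega
        have h1' : n ≠ 1 := by omega
        simp [gwStrong, h0, h1']
      rw [hg]
      have hn0 : (0 : ℝ) < 1 / (n : ℝ) := by
        have : (0 : ℝ) < (n : ℝ) := by exact_mod_cast (show 0 < n by omega)
        positivity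
      have hz := (Finset.sum_eq_zero_iff_of_nonneg hterm).mp hS n (by rw [Finset.mem_Icc]; omega)
      rcases mul_eq_zero.mp hz with h' | h'
      · exact absurd h' (ne_of_gt hn0)
      · exact (pow_eq_zero_iff two_ne_zero).mp h'
  · intro h
    have h1 : W 1 = 1 / (2 * lam) := by
      rw [h 1 (by rw [Finset.mem_Icc]; omega)]
      simp [gwStrong]
    have hS : ∑ n ∈ Finset.Icc 2 L, (1 / (n : ℝ)) * W n ^ 2 = 0 := by
      refine Finset.sum_eq_zero fun n hn => ?_
      rw [Finset.mem_Icc] at hn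
      have h0 : n ≠ 0 := by omega
      have h1' : n ≠ 1 := by omega
      rw [h n (by rw [Finset.mem_Icc]; omega)]
      simp [gwStrong, h0, h1']
    rw [h1, hS]
    ring

/-! ## §3. Toeplitz positivity (a31) implies the printed action-independent bounds (AK §3.1) -/

/-- `𝕋[𝒲₀,…,𝒲_L]` is symmetric, i.e. Hermitian over `ℝ` (so `Matrix.PosSemidef` is the printed `⪰ 0`).
[cite: AndersonKruczenski2017, §3.1 eq. (a34)] -/
theorem toeplitz_isHermitian (W : ℕ → ℝ) (L : ℕ) : (toeplitz W L).IsHermitian :=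
  Matrix.IsHermitian.ext fun i j => by simp [toeplitz, Nat.dist_comm]

/-- The printed `2 × 2` principal minor of `𝕋[𝒲₀,…,𝒲_L]` on rows∕columns `{0, n}` is `[[1, 𝒲_n],[𝒲_n, 1]] = gram2 (W n)`
(`𝒲₀ = 1`, `n ≤ L`). [cite: AndersonKruczenski2017, §3.1 eq. (a36)] -/
theorem toeplitz_submatrix_pair {W : ℕ → ℝ} (h0 : W 0 = 1) {L n : ℕ} (hn : n ≤ L) :
    (toeplitz W L).submatrix ![0, ⟨n, by omega⟩] ![0, ⟨n, by omega⟩] = gram2 (W n) := by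
  ext i j
  fin_cases i <;> fin_cases j <;> simp [toeplitz, gram2, h0, Nat.dist_zero_right, Nat.dist_zero_left]

/-- The printed `3 × 3` principal minor `[[1, 𝒲₁, 𝒲_{n+1}],[𝒲₁, 1, 𝒲_n],[𝒲_{n+1}, 𝒲_n, 1]]` of `𝕋[𝒲₀,…,𝒲_L]`
(rows∕columns `{0, 1, n+1}`, `n + 1 ≤ L`), extracted in the row order `(n+1, 0, 1)` so that it is literally the sibling
module's `gram3 (W (n+1)) (W n) (W 1)`. [cite: AndersonKruczenski2017, §3.1 eq. (a37)] -/
theorem toeplitz_submatrix_triple {W : ℕ → ℝ} (h0 : W 0 = 1) {L n : ℕ} (hn : n + 1 ≤ L) :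
    (toeplitz W L).submatrix ![⟨n + 1, by omega⟩, 0, ⟨1, by omega⟩] ![⟨n + 1, by omega⟩, 0, ⟨1, by omega⟩] =
      gram3 (W (n + 1)) (W n) (W 1) := by
  have h1 : Nat.dist (n + 1) 1 = n := by
    rw [Nat.dist_eq_sub_of_le_right (by omega)]
    omega
  have h2 : Nat.dist 1 (n + 1) = n := by
    rw [Nat.dist_comm, h1]
  ext i j
  fin_cases i <;> fin_cases j <;>
    simp [toeplitz, gram3, h0, h1, h2, Nat.dist_zero_right, Nat.dist_zero_left]

/-- **(a36)** *"the principal minor `[[1, 𝒲_n],[𝒲_n, 1]] ⪰ 0` implies that all loops satisfy `|𝒲_n| ≤ 1`"* — from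
`𝕋[𝒲₀,…,𝒲_L] ⪰ 0` and `𝒲₀ = 1`, for every `n ≤ L`.  PROVED. [cite: AndersonKruczenski2017, §3.1 eq. (a36)] -/
theorem abs_le_one_of_toeplitz {W : ℕ → ℝ} {L : ℕ} (hT : (toeplitz W L).PosSemidef) (h0 : W 0 = 1)
    {n : ℕ} (hn : n ≤ L) : |W n| ≤ 1 := by
  have h := hT.submatrix ![0, ⟨n, by omega⟩]
  rw [toeplitz_submatrix_pair h0 hn] at h
  exact abs_le_one_of_gram2 h

/-- **(a37) ⇒ (a38)** *"`(𝒲_n − 𝒲_{n−1})² ≤ (1−u)(1+u−2𝒲_n𝒲_{n−1})`"* (`u = 𝒲₁`; stated for the consecutive pair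
`(n, n+1)`, `n + 1 ≤ L`) — from `𝕋[𝒲₀,…,𝒲_L] ⪰ 0` and `𝒲₀ = 1`.  PROVED (the printed minor is positive semi-definite
as a principal submatrix, then `sq_sub_le_of_gram3`). [cite: AndersonKruczenski2017, §3.1 eqs. (a37)–(a38)] -/
theorem sq_sub_le_of_toeplitz {W : ℕ → ℝ} {L : ℕ} (hT : (toeplitz W L).PosSemidef) (h0 : W 0 = 1)
    {n : ℕ} (hn : n + 1 ≤ L) :
    (W (n + 1) - W n) ^ 2 ≤ (1 - W 1) * (1 + W 1 - 2 * W (n + 1) * W n) := by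
  have h := hT.submatrix ![⟨n + 1, by omega⟩, 0, ⟨1, by omega⟩]
  rw [toeplitz_submatrix_triple h0 hn] at h
  exact sq_sub_le_of_gram3 h

/-- **(a39)** *"`(𝒲_n − 𝒲_{n−1})² ≤ 4(1−u)`, since `|1+u−2𝒲_n𝒲_{n−1}| ≤ 4` because each loop satisfies
`|𝒲_p| ≤ 1`"* — from `𝕋[𝒲₀,…,𝒲_L] ⪰ 0` and `𝒲₀ = 1` (no hypothesis `u < 1` is needed).  PROVED via the sibling's
`sq_sub_le_four_mul`. [cite: AndersonKruczenski2017, §3.1 eq. (a39)] -/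
theorem sq_sub_le_four_mul_of_toeplitz {W : ℕ → ℝ} {L : ℕ} (hT : (toeplitz W L).PosSemidef) (h0 : W 0 = 1)
    {n : ℕ} (hn : n + 1 ≤ L) : (W (n + 1) - W n) ^ 2 ≤ 4 * (1 - W 1) :=
  sq_sub_le_four_mul (sq_sub_le_of_toeplitz hT h0 hn) (abs_le_one_of_toeplitz hT h0 (show 1 ≤ L by omega))
    (abs_le_one_of_toeplitz hT h0 hn) (abs_le_one_of_toeplitz hT h0 (show n ≤ L by omega))

/-- **"if `𝒲₁ = u = 1` then all loops are equal `𝒲_n = 1` independently of the action!"** — from `𝕋[𝒲₀,…,𝒲_L] ⪰ 0`,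
`𝒲₀ = 1` and `𝒲₁ = 1`, every `𝒲_n` with `n ≤ L` equals `1`.  PROVED (induction on `n` with (a38); compare the
sibling's `all_loops_one`, which takes the minors as hypotheses). [cite: AndersonKruczenski2017, §3.1 (the sentence after eq. (a38))] -/
theorem all_loops_one_of_toeplitz {W : ℕ → ℝ} {L : ℕ} (hT : (toeplitz W L).PosSemidef) (h0 : W 0 = 1)
    (h1 : W 1 = 1) {n : ℕ} (hn : n ≤ L) : W n = 1 := by
  induction n with
  | zero => exact h0
  | succ k ih =>
    have hk := ih (by omega)
    have h := sq_sub_le_of_toeplitz hT h0 (n := k) hn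
    rw [hk, h1] at h
    nlinarith [sq_nonneg (W (k + 1) - 1)]

/-! ## §4. The strong-coupling sequence against Toeplitz positivity (AK §3.2, the sentences after (a47)) -/

/-- The superdiagonal shift on `Fin (L+1)` (plumbing for the tridiagonal matrix `𝕋[1, 1/(2λ), 0, …, 0]`). [folklore] -/
private def shiftMat (L : ℕ) : Matrix (Fin (L + 1)) (Fin (L + 1)) ℝ :=
  Matrix.of fun i j => if j.val = i.val + 1 then 1 else 0

/-- `𝕋[𝒲₀,…,𝒲_L]` of the strong-coupling sequence is the tridiagonal `1 + (1/(2λ))·(shift + shiftᵀ)`. [folklore] -/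
private theorem toeplitz_gwStrong_eq (lam : ℝ) (L : ℕ) :
    toeplitz (gwStrong lam) L = 1 + (1 / (2 * lam)) • (shiftMat L + (shiftMat L)ᵀ) := by
  ext i j
  simp only [toeplitz, gwStrong, Matrix.add_apply, Matrix.one_apply, Matrix.smul_apply,
    Matrix.transpose_apply, shiftMat, Matrix.of_apply, smul_eq_mul, Nat.dist, Fin.ext_iff]
  split_ifs <;> first | omega | ring

/-- The shift acts by `(Sx)_i = x_{i+1}` (and `0` in the last row). [folklore] -/
private theorem shiftMat_mulVec (L : ℕ) (x : Fin (L + 1) → ℝ) (i : Fin (L + 1)) :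
    (shiftMat L *ᵥ x) i = if h : i.val + 1 < L + 1 then x ⟨i.val + 1, h⟩ else 0 := by
  simp only [Matrix.mulVec, dotProduct, shiftMat, Matrix.of_apply]
  split_ifs with h
  · rw [Finset.sum_eq_single ⟨i.val + 1, h⟩]
    · simp
    · intro j _ hj
      have : j.val ≠ i.val + 1 := fun e => hj (Fin.ext e)
      simp [this]
    · simp
  · refine Finset.sum_eq_zero fun j _ => ?_
    have : j.val ≠ i.val + 1 := by omega
    simp [this]

/-- `xᵀ S x = Σ_{k<L} x_k x_{k+1}`. [folklore] -/
private theorem dotProduct_shiftMat_mulVec (L : ℕ) (x : Fin (L + 1) → ℝ) :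
    x ⬝ᵥ (shiftMat L *ᵥ x) = ∑ k : Fin L, x k.castSucc * x k.succ := by
  simp only [dotProduct, shiftMat_mulVec]
  rw [Fin.sum_univ_castSucc]
  have hlast : ¬ ((Fin.last L).val + 1 < L + 1) := by simp
  rw [dif_neg hlast, mul_zero, add_zero]
  refine Finset.sum_congr rfl fun k _ => ?_
  have hk : (Fin.castSucc k).val + 1 < L + 1 := by simp
  rw [dif_pos hk]
  rfl

/-- `xᵀ Sᵀ x = xᵀ S x`. [folklore] -/
private theorem dotProduct_shiftMat_transpose_mulVec (L : ℕ) (x : Fin (L + 1) → ℝ) :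
    x ⬝ᵥ ((shiftMat L)ᵀ *ᵥ x) = x ⬝ᵥ (shiftMat L *ᵥ x) := by
  rw [Matrix.mulVec_transpose, dotProduct_comm, ← Matrix.dotProduct_mulVec]

/-- **The quadratic form of `𝕋[1, 1/(2λ), 0, …, 0]`** (the Toeplitz matrix of the strong-coupling sequence):
`xᵀ𝕋x = Σ_i x_i² + (1/λ) Σ_{k<L} x_k x_{k+1}`.  PROVED.
[cite: AndersonKruczenski2017, §3.2 (the eigenvalue sentence after eq. (a47)); §3.1 eq. (a31)] -/
theorem toeplitz_gwStrong_quadForm (lam : ℝ) (L : ℕ) (x : Fin (L + 1) → ℝ) :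
    x ⬝ᵥ (toeplitz (gwStrong lam) L *ᵥ x) = x ⬝ᵥ x + (1 / lam) * ∑ k : Fin L, x k.castSucc * x k.succ := by
  rw [toeplitz_gwStrong_eq, Matrix.add_mulVec, Matrix.one_mulVec, Matrix.smul_mulVec, Matrix.add_mulVec,
    dotProduct_add, dotProduct_smul, dotProduct_add, dotProduct_shiftMat_transpose_mulVec,
    dotProduct_shiftMat_mulVec, smul_eq_mul]
  ring

/-- The alternating test vector `x_i = (−1)^i`. [folklore] -/
private def altVec (L : ℕ) : Fin (L + 1) → ℝ := fun i => (-1) ^ i.val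

/-- `‖x‖² = L + 1` for the alternating vector (plumbing). [folklore] -/
private theorem altVec_dotProduct_self (L : ℕ) : altVec L ⬝ᵥ altVec L = (L : ℝ) + 1 := by
  have h : ∀ i : Fin (L + 1), altVec L i * altVec L i = 1 := by
    intro i
    simp only [altVec]
    rw [← pow_add, ← two_mul, pow_mul, neg_one_sq, one_pow]
  simp only [dotProduct, h, Finset.sum_const, Finset.card_univ, Fintype.card_fin, nsmul_eq_mul, mul_one]
  push_cast
  ring

/-- `Σ_{k<L} x_k x_{k+1} = −L` for the alternating vector (plumbing). [folklore] -/
private theorem altVec_shift_sum (L : ℕ) : ∑ k : Fin L, altVec L k.castSucc * altVec L k.succ = -(L : ℝ) := by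
  have h : ∀ k : Fin L, altVec L k.castSucc * altVec L k.succ = -1 := by
    intro k
    simp only [altVec, Fin.val_castSucc, Fin.val_succ, pow_succ]
    have hk : ((-1 : ℝ) ^ k.val) * ((-1 : ℝ) ^ k.val) = 1 := by
      rw [← pow_add, ← two_mul, pow_mul, neg_one_sq, one_pow]
    linear_combination (-1 : ℝ) * hk
  simp only [h, Finset.sum_const, Finset.card_univ, Fintype.card_fin, nsmul_eq_mul, mul_neg, mul_one]

/-- On the alternating vector `x_i = (−1)^i` the quadratic form of `𝕋[1, 1/(2λ), 0, …, 0]` equals `L + 1 − L/λ`.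
[cite: AndersonKruczenski2017, §3.2 (the eigenvalue sentence after eq. (a47))] -/
theorem toeplitz_gwStrong_altVec (lam : ℝ) (L : ℕ) :
    (fun i : Fin (L + 1) => ((-1 : ℝ) ^ i.val)) ⬝ᵥ
        (toeplitz (gwStrong lam) L *ᵥ fun i : Fin (L + 1) => ((-1 : ℝ) ^ i.val)) =
      (L : ℝ) + 1 - (L : ℝ) / lam := by
  have := toeplitz_gwStrong_quadForm lam L (altVec L)
  rw [altVec_dotProduct_self, altVec_shift_sum] at this
  change altVec L ⬝ᵥ (toeplitz (gwStrong lam) L *ᵥ altVec L) = _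
  rw [this]
  ring

/-- **"for `λ < 1` the corresponding matrices `ρ^{L}` are not all positive definite"**, quantitatively: if `0 < λ` and
`λ(L+1) < L` then `𝕋[𝒲₀,…,𝒲_L]` of the strong-coupling sequence is NOT positive semi-definite (witness: the alternating
vector).  PROVED. [cite: AndersonKruczenski2017, §3.2 (the two sentences after eq. (a47))] -/
theorem toeplitz_gwStrong_not_posSemidef {lam : ℝ} (hlam : 0 < lam) {L : ℕ} (hL : lam * ((L : ℝ) + 1) < L) :
    ¬ (toeplitz (gwStrong lam) L).PosSemidef := by
  intro h
  have hq := h.dotProduct_mulVec_nonneg (altVec L)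
  rw [star_trivial] at hq
  change 0 ≤ (fun i : Fin (L + 1) => ((-1 : ℝ) ^ i.val)) ⬝ᵥ
      (toeplitz (gwStrong lam) L *ᵥ fun i : Fin (L + 1) => ((-1 : ℝ) ^ i.val)) at hq
  rw [toeplitz_gwStrong_altVec] at hq
  have hlt : (L : ℝ) + 1 < (L : ℝ) / lam := by
    rw [lt_div_iff₀ hlam]
    linarith
  linarith

/-- **Every `0 < λ < 1` is excluded by Toeplitz positivity at some finite `L`** (any `L > λ/(1−λ)`): although the
strong-coupling sequence solves the loop equations at every coupling (`gwStrong_loopEq2D`), it is not an admissible planar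
loop sequence at weak coupling — the printed mechanism by which positivity, not the loop equation, removes the root
`u = 1/(2λ)` below the Gross–Witten point.  PROVED.
[cite: AndersonKruczenski2017, §3.2 (the two sentences after eq. (a47)); §3.3] -/
theorem exists_toeplitz_gwStrong_not_posSemidef {lam : ℝ} (h0 : 0 < lam) (h1 : lam < 1) :
    ∃ L : ℕ, ¬ (toeplitz (gwStrong lam) L).PosSemidef := by
  obtain ⟨L, hL⟩ := exists_nat_gt (lam / (1 - lam))
  refine ⟨L, toeplitz_gwStrong_not_posSemidef h0 ?_⟩
  have h1' : 0 < 1 - lam := by linarith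
  rw [div_lt_iff₀ h1'] at hL
  nlinarith

/-- **At strong coupling `λ ≥ 1` the strong-coupling sequence passes every Toeplitz positivity constraint**:
`𝕋[1, 1/(2λ), 0, …, 0] ⪰ 0` for all `L` (since `xᵀ𝕋x ≥ (1 − 1/λ)‖x‖² ≥ 0`).  With `gwStrong_loopEq2D` and
`exists_toeplitz_gwStrong_not_posSemidef`: for `λ > 0`, the root `u = 1/(2λ)` of the loop equations satisfies all the
positivity constraints (a31) iff `λ ≥ 1`.  PROVED.
[cite: AndersonKruczenski2017, §3.2 (after eq. (a47)) with §3.1 ("For finite L, the strong coupling solutions lies in the interior")] -/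
theorem toeplitz_gwStrong_posSemidef {lam : ℝ} (hlam : 1 ≤ lam) (L : ℕ) :
    (toeplitz (gwStrong lam) L).PosSemidef := by
  refine Matrix.PosSemidef.of_dotProduct_mulVec_nonneg (toeplitz_isHermitian _ _) fun x => ?_
  rw [star_trivial, toeplitz_gwStrong_quadForm]
  have hxx : x ⬝ᵥ x = ∑ i, x i ^ 2 := by
    simp only [dotProduct, sq]
  have hcs : ∑ k : Fin L, x k.castSucc ^ 2 ≤ x ⬝ᵥ x := by
    rw [hxx, Fin.sum_univ_castSucc]
    linarith [sq_nonneg (x (Fin.last L))]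
  have hsucc : ∑ k : Fin L, x k.succ ^ 2 ≤ x ⬝ᵥ x := by
    rw [hxx, Fin.sum_univ_succ]
    linarith [sq_nonneg (x 0)]
  have h2 : -(∑ k : Fin L, x k.castSucc ^ 2 + ∑ k : Fin L, x k.succ ^ 2) ≤
      2 * ∑ k : Fin L, x k.castSucc * x k.succ := by
    rw [← Finset.sum_add_distrib, Finset.mul_sum, ← Finset.sum_neg_distrib]
    exact Finset.sum_le_sum fun k _ => by nlinarith [sq_nonneg (x k.castSucc + x k.succ)]
  have hS : -(x ⬝ᵥ x) ≤ ∑ k : Fin L, x k.castSucc * x k.succ := by linarith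
  have hx0 : 0 ≤ x ⬝ᵥ x := by
    rw [hxx]
    exact Finset.sum_nonneg fun i _ => sq_nonneg _
  have hl0 : 0 < 1 / lam := by positivity
  have hl1 : 1 / lam ≤ 1 := by
    rw [div_le_one (by linarith)]
    exact hlam
  nlinarith [mul_le_mul_of_nonneg_left hS hl0.le, mul_le_mul_of_nonneg_right hl1 hx0]

end Literature.MathematicalPhysics.QuantumFieldTheory.AndersonKruczenski2017

end
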